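import Summits.QuantumFields.BalabanUV.Beta.MultiscaleDecay

/-!
# Beta / MultiscaleParametrixHull — NODE (w4-a′), SECOND PIECE: THE HULL OF A BOX AS THE UNION OF THE FAMILY CELLS MEETING A
# BALL, AND THE THREE HULL CLAUSES OF `MultiscaleParametrixTorus.parametrix_torus_adapted` DISCHARGED FROM «supp h ⊆ ball»
# (MODEL; torus `UT N` with a covering cube family — the SHAPE of print's Ω₀(□) ⊃ □̃, [B9] p. 408)

For the covering disjoint cube family of `MultiscaleDecay` and a box with centre `c` and radius `ρ`, the hull
`cellHull c ρ : UT N → ℝ` is the indicator of the union of the family cells that meet the closed `(ρ + 1)`-ball round `c`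
(torus distance of `B5TorusCover`).  Then (all [folklore] bookkeeping):
* `cellHull_zero_or_one`; **`cellHull_cellPt`**: constant on every family cell (clause `hχcell`);
* **`cellHull_eq_one_of_dist_le`**: `= 1` at every site within `ρ + 1` of `c`; hence for ANY bump `h` with
  `supp h ⊆ ball(c, ρ)`: **`hsite_of_supp`** (`h x ≠ 0 ⟹ χ x = 1`) and **`hbond_of_supp`** (both ends of every bond meeting
  `supp h` lie in the hull — bond ends are at distance `≤ 1`, b05 `dist_up_le`);
* **`scale_le_of_cellHull`**: if every cell meeting the `(ρ + 1)`-ball has side `≤ n_H` then every hull site has site scale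
  `≤ n_H` (clause `hH`).
What remains GEOMETRIC in (w4-a′) after this module: the bound `n_H ≤ L·n_z` for the cells meeting a box's ball (from the
additive grading datum of (ii-a) §4 and the layer thickness) and the overlap count `Σ_z χ_z ≤ ν` (packing of the box centres);
what remains ANALYTIC: the layer partition `ψ_j` (O.2 skeleton v1.5.0 §8.10; unit `b2b-balaban-beta-d4-p2`, GEN 9, MODEL crew).

HONEST FRAMING: discharging `BetaPertH` makes Bałaban's UV stability UNCONDITIONAL — NOT the continuum limit, NOT the
Clay problem.  HONEST DEPENDENCY (verbatim): «continuum YM on T⁴ ⇐ BetaPertH ∧ nine spine estimates (0/9 proved);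
BetaPertH ⇐ (D1) ∧ (D4) ∧ CAP+tail; G-an2-4 gates asym, D1 and NE2/3/4.»  THIS MODULE DISCHARGES NOTHING of `BetaPertH`,
asserts NOTHING printed and cites nothing as a fact (ABSOLUTE RULE): [folklore] about the MODEL's cube family on the torus.
LOCI (shape only): [B9] = `Balaban1985BackgroundPropagators` p. 408 («Ω₀(□) … □̃⁴ ⊂ Ω₀(□) ⊂ □̃⁵», a union of big cubes round
the support of `h_□`); [B6] = `Balaban1984PropagatorsII` (2.37) p. 229.  No class change on row D4 (critical-path width 0; D4
DISCHARGE NO DATE); NOT BetaPertH, NOT continuum, NOT Clay, NOT summit progress.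
-/

namespace Summit.QuantumFields.BalabanUV.Beta.MultiscaleParametrixHull

open Finset Function
open Summit.QuantumFields.BalabanUV.Beta.BoxPoincare (Box)
open Summit.QuantumFields.BalabanUV.Beta.MultiscaleCoerciveTorus
open Summit.QuantumFields.BalabanUV.Beta.MultiscaleDecayBudget
open Literature.MathematicalPhysics.QuantumFieldTheory.Balaban1983to89
open Literature.MathematicalPhysics.QuantumFieldTheory.Balaban1983to89.B9Thm37GluePU (bsrc btgt bsrc_apply btgt_apply)
open B5TorusCover (UT Ctr ctrU)
open B5Leibniz121 (up dist_up_le)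

noncomputable section

variable {d : ℕ} {N : Fin d → ℕ} [∀ i, NeZero (N i)] {J K : Type}
  (S : J → ℕ) (hS : ∀ l, 1 ≤ S l) (hdivS : ∀ l i, S l ∣ N i) (lvl : K → J) (zc : (k : K) → Ctr N (S (lvl k)))

/-- A cell MEETS the closed ball of radius `r` round `c`. [folklore] -/
def CellMeets (k : K) (c : UT N) (r : ℝ) : Prop := ∃ v : Box d (S (lvl k)), dist (cellPt S hS hdivS lvl zc k v) c ≤ r

open Classical in
/-- MODEL of Ω₀(□): **the hull of the box (centre `c`, radius `ρ`)** = the indicator of the union of the family cells meeting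
the closed `(ρ + 1)`-ball round `c` (for a COVERING family: the cell of `x` meets that ball).
[cite: Balaban1985BackgroundPropagators, p.408 (Ω₀(□))] -/
def cellHull (hcover : ∀ x : UT N, ∃ k, ∃ v : Box d (S (lvl k)), cellPt S hS hdivS lvl zc k v = x) (c : UT N) (ρ : ℕ)
    (x : UT N) : ℝ :=
  if CellMeets S hS hdivS lvl zc (cellOf S hS hdivS lvl zc hcover x) c (ρ + 1) then 1 else 0

variable (hcover : ∀ x : UT N, ∃ k, ∃ v : Box d (S (lvl k)), cellPt S hS hdivS lvl zc k v = x)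

/-- The hull is {0,1}-valued. [folklore] -/
theorem cellHull_zero_or_one (c : UT N) (ρ : ℕ) (x : UT N) :
    cellHull S hS hdivS lvl zc hcover c ρ x = 0 ∨ cellHull S hS hdivS lvl zc hcover c ρ x = 1 := by
  unfold cellHull
  split_ifs
  · exact Or.inr rfl
  · exact Or.inl rfl

/-- **The hull is constant on every family cell** (clause `hχcell` of `parametrix_torus_adapted`; disjoint family). [folklore] -/
theorem cellHull_cellPt (hdisj : ∀ k k' v v', cellPt S hS hdivS lvl zc k v = cellPt S hS hdivS lvl zc k' v' → k = k')
    (c : UT N) (ρ : ℕ) (k : K) (v : Box d (S (lvl k))) :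
    cellHull S hS hdivS lvl zc hcover c ρ (cellPt S hS hdivS lvl zc k v) =
      cellHull S hS hdivS lvl zc hcover c ρ (ctrU N (S (lvl k)) (zc k)) := by
  have h0 : ctrU N (S (lvl k)) (zc k) = cellPt S hS hdivS lvl zc k (fun _ => ⟨0, hS (lvl k)⟩) := by
    rw [cellPt, cubePt_zero]
  unfold cellHull
  rw [h0, cellOf_cellPt S hS hdivS lvl zc hdisj hcover, cellOf_cellPt S hS hdivS lvl zc hdisj hcover]

/-- **The hull contains the closed `(ρ + 1)`-ball**: `dist x c ≤ ρ + 1 ⟹ χ(x) = 1` (the cell of `x` meets the ball at `x`).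
[folklore] -/
theorem cellHull_eq_one_of_dist_le (c : UT N) (ρ : ℕ) {x : UT N} (hx : dist x c ≤ ρ + 1) :
    cellHull S hS hdivS lvl zc hcover c ρ x = 1 := by
  unfold cellHull
  rw [if_pos]
  obtain ⟨v, hv⟩ := cellOf_spec S hS hdivS lvl zc hcover x
  exact ⟨v, by rw [hv]; exact hx⟩

/-- **Clause `hsite`**: a bump supported in the `ρ`-ball round `c` is carried by the hull. [folklore] -/
theorem hsite_of_supp (c : UT N) (ρ : ℕ) {h : UT N → ℝ} (hsupp : ∀ x, h x ≠ 0 → dist x c ≤ ρ) (x : UT N) (hx : h x ≠ 0) :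
    cellHull S hS hdivS lvl zc hcover c ρ x = 1 :=
  cellHull_eq_one_of_dist_le S hS hdivS lvl zc hcover c ρ ((hsupp x hx).trans (by linarith))

/-- **Clause `hbond`**: both ends of every bond meeting the support of such a bump lie in the hull (bond ends are at torus
distance `≤ 1`, b05 `dist_up_le`). [cite: Balaban1985BackgroundPropagators, p.408 (Ω₀(□) ⊃ □̃)] -/
theorem hbond_of_supp (c : UT N) (ρ : ℕ) {h : UT N → ℝ} (hsupp : ∀ x, h x ≠ 0 → dist x c ≤ ρ) (b : UT N × Fin d)
    (hb : h (bsrc b) ≠ 0 ∨ h (btgt b) ≠ 0) :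
    cellHull S hS hdivS lvl zc hcover c ρ (bsrc b) = 1 ∧ cellHull S hS hdivS lvl zc hcover c ρ (btgt b) = 1 := by
  obtain ⟨y, μ⟩ := b
  rw [bsrc_apply, btgt_apply] at hb ⊢
  have hd1 : dist y (up y μ) ≤ 1 := dist_up_le y μ
  rcases hb with hy | hy
  · have hy' := hsupp y hy
    refine ⟨cellHull_eq_one_of_dist_le S hS hdivS lvl zc hcover c ρ (hy'.trans (by linarith)),
      cellHull_eq_one_of_dist_le S hS hdivS lvl zc hcover c ρ ?_⟩
    calc dist (up y μ) c ≤ dist (up y μ) y + dist y c := dist_triangle _ _ _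
      _ ≤ 1 + ρ := add_le_add (by rw [dist_comm]; exact hd1) hy'
      _ = ρ + 1 := add_comm _ _
  · have hy' := hsupp (up y μ) hy
    refine ⟨cellHull_eq_one_of_dist_le S hS hdivS lvl zc hcover c ρ ?_,
      cellHull_eq_one_of_dist_le S hS hdivS lvl zc hcover c ρ (hy'.trans (by linarith))⟩
    calc dist y c ≤ dist y (up y μ) + dist (up y μ) c := dist_triangle _ _ _
      _ ≤ 1 + ρ := add_le_add hd1 hy'
      _ = ρ + 1 := add_comm _ _

/-- **Clause `hH`**: if every family cell meeting the `(ρ + 1)`-ball has side `≤ n_H`, every hull site has site scale `≤ n_H`.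
[folklore] -/
theorem scale_le_of_cellHull (c : UT N) (ρ : ℕ) {nH : ℕ}
    (hcells : ∀ k, CellMeets S hS hdivS lvl zc k c (ρ + 1) → S (lvl k) ≤ nH) (x : UT N)
    (hx : cellHull S hS hdivS lvl zc hcover c ρ x = 1) : siteScale S hS hdivS lvl zc hcover x ≤ nH := by
  unfold cellHull at hx
  by_cases hm : CellMeets S hS hdivS lvl zc (cellOf S hS hdivS lvl zc hcover x) c (ρ + 1)
  · exact hcells _ hm
  · rw [if_neg hm] at hx; exact absurd hx (by norm_num)

/-- The hull vanishes on the cells that do not meet the `(ρ + 1)`-ball (so a box whose ball meets no weighted cell of a level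
contributes no oscillation there). [folklore] -/
theorem cellHull_eq_zero_of_not_meets (hdisj : ∀ k k' v v', cellPt S hS hdivS lvl zc k v = cellPt S hS hdivS lvl zc k' v' → k = k')
    (c : UT N) (ρ : ℕ) (k : K) (hk : ¬ CellMeets S hS hdivS lvl zc k c (ρ + 1)) (v : Box d (S (lvl k))) :
    cellHull S hS hdivS lvl zc hcover c ρ (cellPt S hS hdivS lvl zc k v) = 0 := by
  unfold cellHull
  rw [cellOf_cellPt S hS hdivS lvl zc hdisj hcover, if_neg hk]

/-- **The three hull clauses at once, for a box family**: bumps `h_z` supported in the `ρ_z`-balls round centres `c_z`, hulls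
`χ_z = cellHull c_z ρ_z` ⟹ `hχ`, `hχcell`, `hsite`, `hbond` of `MultiscaleParametrixTorus.parametrix_torus_adapted`, and `hH`
from a side bound on the cells meeting each `(ρ_z + 1)`-ball. [cite: Balaban1985BackgroundPropagators, p.408 (Ω₀(□)); Balaban1984PropagatorsII, (2.37) p.229] -/
theorem hull_clauses {ι : Type} (hdisj : ∀ k k' v v', cellPt S hS hdivS lvl zc k v = cellPt S hS hdivS lvl zc k' v' → k = k')
    (cz : ι → UT N) (ρ : ι → ℕ) (hs : ι → UT N → ℝ) (hsupp : ∀ z x, hs z x ≠ 0 → dist x (cz z) ≤ ρ z) (nH : ι → ℕ)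
    (hcells : ∀ z k, CellMeets S hS hdivS lvl zc k (cz z) (ρ z + 1) → S (lvl k) ≤ nH z) :
    (∀ z x, cellHull S hS hdivS lvl zc hcover (cz z) (ρ z) x = 0 ∨ cellHull S hS hdivS lvl zc hcover (cz z) (ρ z) x = 1) ∧
      (∀ z k v, cellHull S hS hdivS lvl zc hcover (cz z) (ρ z) (cellPt S hS hdivS lvl zc k v) =
        cellHull S hS hdivS lvl zc hcover (cz z) (ρ z) (ctrU N (S (lvl k)) (zc k))) ∧
      (∀ z x, hs z x ≠ 0 → cellHull S hS hdivS lvl zc hcover (cz z) (ρ z) x = 1) ∧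
      (∀ z b, (hs z (bsrc b) ≠ 0 ∨ hs z (btgt b) ≠ 0) →
        cellHull S hS hdivS lvl zc hcover (cz z) (ρ z) (bsrc b) = 1 ∧ cellHull S hS hdivS lvl zc hcover (cz z) (ρ z) (btgt b) = 1) ∧
      (∀ z x, cellHull S hS hdivS lvl zc hcover (cz z) (ρ z) x = 1 → siteScale S hS hdivS lvl zc hcover x ≤ nH z) :=
  ⟨fun z x => cellHull_zero_or_one S hS hdivS lvl zc hcover (cz z) (ρ z) x,
    fun z k v => cellHull_cellPt S hS hdivS lvl zc hcover hdisj (cz z) (ρ z) k v,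
    fun z x hx => hsite_of_supp S hS hdivS lvl zc hcover (cz z) (ρ z) (hsupp z) x hx,
    fun z b hb => hbond_of_supp S hS hdivS lvl zc hcover (cz z) (ρ z) (hsupp z) b hb,
    fun z x hx => scale_le_of_cellHull S hS hdivS lvl zc hcover (cz z) (ρ z) (hcells z) x hx⟩

end

end Summit.QuantumFields.BalabanUV.Beta.MultiscaleParametrixHull
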